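import Literature.NumberTheory.Rogawski1990.LocalTransferChartJunctionCM             -- ★ F0P2-p02 (g8): §2 `exists_localTransfer_of_matchedChart_nonsplit` (the matched chart at CM)
import Literature.NumberTheory.Rogawski1990.LocalNormFibreSurjectiveNonsplit           -- ★ p840547-lineage A-p13 (g30) (J-e-2) `exists_isLocalGRegular_isLocalNormPair_of_isRoot`
import Literature.NumberTheory.Rogawski1990.RegularOrbitalIntegralLocallyConstantCM    -- ★ p03 (g10) (G1-i) `eventually_classOrbitalIntegral_mk_eq_cmDatum_local` (ED. 2)
import HarnessLib

/-!
# SMOOTH TRANSFER ON THE REGULAR SET AT A NON-SPLIT PLACE — the (hloc) junction ASSEMBLED (Rogawski 1990 Prop. 4.9.1 (a), floor-2 letter «N6-ns-reg»)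

Topic `NumberTheory/Rogawski1990`; namespace `Literature.NumberTheory.Rogawski1990`.  ONE THEOREM (no definition, no instance, no notation, no named fact, no `sorry`).
Cell `pub/hodgecm-mathlib` (D-0151), crux H413 = stmt-HodgeConjecture-24833, F0∕P3a road «D-N6-ns», THE HEADLINE of the junction (LEAD F0P3a-plan (g9) T8-25 (B)); seat
F0P2-p02 (g8).  `exists_localTransfer_of_tsupport_subset_regular_nonsplit`: with the explicit `Δ_v`, canonical measure families, the torus-coordinate chart data on both
sides (binders `hchartH` = A-p16 (2ᵀ), `hchartG` = A-p16 (1ᵀ)) and the local constancy of regular orbital integrals along the `G′`-tori (binder `hOlcG` = F0P3a-p03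
(G1-i)), every `φ ∈ C_c^∞(U(H′)(L⁺_v))` with `tsupport φ ⊆ G′_v^{reg}` has a `C_c^∞` transfer.  COVER: matched charts (★ §2 of the junction file, ★ `exists_finset_normFibre`,
★ (J-e-2)) ∪ the open unmatched locus (★ `isOpen_setOf_forall_not_isRoot_charpoly`, ★ `exists_localTransfer_of_tsupport_subset_unmatched`); GLUE: ★
`exists_localTransfer_of_cover`.  ED. 2 rider `…_of_charts`: (G1-i) discharged by ★ `eventually_classOrbitalIntegral_mk_eq_cmDatum_local` (p03 (g10)).  HONEST LABEL: HC_CM is proved only modulo the printed citations until rung 0 closes; this file proves no letter by itself (the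
letter «N6-ns» also wants the singular support, floor 3).

## References
* [Rogawski1990] J. Rogawski, *Automorphic Representations of Unitary Groups in Three Variables*, Ann. of Math. Stud. 123 (1990): §4.9 Prop. 4.9.1 (a) pp. 54–55; §4.3 (4.3.1)–(4.3.2) pp. 42–44; §5.4 p. 78.
* [LanglandsShelstad1987] R. P. Langlands, D. Shelstad, Math. Ann. 278 (1987): §1.3.  [HarishChandra1970] LNM 162, Part I §3.
-/

set_option autoImplicit false

noncomputable section

open Set Filter Topology MeasureTheory Polynomial
open scoped Pointwise Matrix

namespace Literature.NumberTheory.Rogawski1990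

open Literature.NumberTheory.Automorphic Literature.NumberTheory.Automorphic.UnitaryGroup Literature.NumberTheory.GaloisRepresentations
open _root_.NumberField _root_.IsDedekindDomain

section Headline

variable (L : Type) [Field L] [NumberField L] [IsCMField L] (H' : Matrix (Fin 3) (Fin 3) L) (v : HeightOneSpectrum (𝓞 ↥(maximalRealSubfield L)))
  [MeasurableSpace ((cmDatum L 2 (Matrix.of fun i j : Fin 2 => if i.val + j.val + 1 = 2 then (1 : L) else 0)).Local v ×
      (cmDatum L 1 (Matrix.of fun i j : Fin 1 => if i.val + j.val + 1 = 1 then (1 : L) else 0)).Local v)] [BorelSpace ((cmDatum L 2 (Matrix.of fun i j : Fin 2 => if i.val + j.val + 1 = 2 then (1 : L) else 0)).Local v ×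
      (cmDatum L 1 (Matrix.of fun i j : Fin 1 => if i.val + j.val + 1 = 1 then (1 : L) else 0)).Local v)]
  [MeasurableSpace ((cmDatum L 3 H').Local v)] [BorelSpace ((cmDatum L 3 H').Local v)]
  [iM' : ∀ γ : (cmDatum L 3 H').Local v, MeasurableSpace ((cmDatum L 3 H').Local v ⧸ Subgroup.centralizer ({γ} : Set ((cmDatum L 3 H').Local v)))]
  [iB' : ∀ γ : (cmDatum L 3 H').Local v, BorelSpace ((cmDatum L 3 H').Local v ⧸ Subgroup.centralizer ({γ} : Set ((cmDatum L 3 H').Local v)))]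
  [iH : ∀ a : ((cmDatum L 2 (Matrix.of fun i j : Fin 2 => if i.val + j.val + 1 = 2 then (1 : L) else 0)).Local v ×
      (cmDatum L 1 (Matrix.of fun i j : Fin 1 => if i.val + j.val + 1 = 1 then (1 : L) else 0)).Local v), MeasurableSpace (((cmDatum L 2 (Matrix.of fun i j : Fin 2 => if i.val + j.val + 1 = 2 then (1 : L) else 0)).Local v ×
      (cmDatum L 1 (Matrix.of fun i j : Fin 1 => if i.val + j.val + 1 = 1 then (1 : L) else 0)).Local v) ⧸ Subgroup.centralizer ({a} : Set ((cmDatum L 2 (Matrix.of fun i j : Fin 2 => if i.val + j.val + 1 = 2 then (1 : L) else 0)).Local v ×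
      (cmDatum L 1 (Matrix.of fun i j : Fin 1 => if i.val + j.val + 1 = 1 then (1 : L) else 0)).Local v)))]
  [iHB : ∀ a : ((cmDatum L 2 (Matrix.of fun i j : Fin 2 => if i.val + j.val + 1 = 2 then (1 : L) else 0)).Local v ×
      (cmDatum L 1 (Matrix.of fun i j : Fin 1 => if i.val + j.val + 1 = 1 then (1 : L) else 0)).Local v), BorelSpace (((cmDatum L 2 (Matrix.of fun i j : Fin 2 => if i.val + j.val + 1 = 2 then (1 : L) else 0)).Local v ×
      (cmDatum L 1 (Matrix.of fun i j : Fin 1 => if i.val + j.val + 1 = 1 then (1 : L) else 0)).Local v) ⧸ Subgroup.centralizer ({a} : Set ((cmDatum L 2 (Matrix.of fun i j : Fin 2 => if i.val + j.val + 1 = 2 then (1 : L) else 0)).Local v ×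
      (cmDatum L 1 (Matrix.of fun i j : Fin 1 => if i.val + j.val + 1 = 1 then (1 : L) else 0)).Local v)))]

/-- **(T1) «N6-ns-reg»: SMOOTH TRANSFER ON THE REGULAR SET AT A NON-SPLIT PLACE (Rogawski 1990 Prop. 4.9.1 (a) ∕ (4.3.1), the (hloc) junction ASSEMBLED).**
At a finite place `v` of `L⁺` with ONE place `w` of `L` above it: given the explicit transfer factor `Δ_v = (finExplicitCollection μ) v`, CANONICAL orbital measure
families, the torus-coordinate chart data on BOTH sides (`hchartH` = A-p16 (2ᵀ) at every `G`-regular `γ_H`; `hchartG` = A-p16 (1ᵀ) at every regular `γ₀ ∈ G′_v`,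
with shrinking) and the local constancy of the regular orbital integrals along the tori of `G′_v` (`hOlcG` = F0P3a-p03 (G1-i)), EVERY `φ ∈ C_c^∞(G′_v)` with
`tsupport φ ⊆ G′_v^{reg}` has a `C_c^∞` transfer: `∃ φ^H ∈ C_c^∞(H_v), IsLocalDeltaTransfer Δ_v mH mG φ^H φ`.
PROOF (the cover `G′_v^{reg} = ⋃ (matched charts) ∪ (no norm-one root)`): a regular `γ` either has a `U(Φ₁)_v`-root of `charpoly γ` — then it is matched by a
`G`-regular `γ_H` (★ `exists_isLocalGRegular_isLocalNormPair_of_isRoot`, A-p13 (J-e-2)) and §2 `exists_localTransfer_of_matchedChart_nonsplit` (with ★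
`exists_finset_normFibre`) is an open chart around it with local transfers — or it lies in the OPEN unmatched locus (★ `isOpen_setOf_forall_not_isRoot_charpoly`,
★ `exists_localTransfer_of_tsupport_subset_unmatched`: `ψ^H := 0`); glue by the smooth partition of unity ★ `exists_localTransfer_of_cover` (p839896).
HONEST LABEL: modulo the binders `hchartH`, `hchartG`, `hOlcG` (feeders of record); HC_CM is proved only modulo the printed citations until rung 0 closes.
[cite: Rogawski1990, §4.9 Prop. 4.9.1 (a) pp. 54–55; §4.3 (4.3.1)–(4.3.2) pp. 42–44; §5.4 p. 78] [cite: LanglandsShelstad1987, §1.3] [cite: HarishChandra1970, Part I §3] -/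
theorem exists_localTransfer_of_tsupport_subset_regular_nonsplit (w : PlacesOver L v) (hw : IsCMField.complexConj L • w.1 = w.1)
    (hH' : (H'.map (cmConjRingHom L))ᵀ = H') (hdet' : H'.det ≠ 0) (μ : HeckeCharacter L)
    (hl : ∀ (v : HeightOneSpectrum (𝓞 ↥(maximalRealSubfield L))) (a : ((cmDatum L 2 (Matrix.of fun i j : Fin 2 => if i.val + j.val + 1 = 2 then (1 : L) else 0)).Local v ×
      (cmDatum L 1 (Matrix.of fun i j : Fin 1 => if i.val + j.val + 1 = 1 then (1 : L) else 0)).Local v)) (b : (cmDatum L 3 H').Local v) (x : ((cmDatum L 2 (Matrix.of fun i j : Fin 2 => if i.val + j.val + 1 = 2 then (1 : L) else 0)).Local v ×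
      (cmDatum L 1 (Matrix.of fun i j : Fin 1 => if i.val + j.val + 1 = 1 then (1 : L) else 0)).Local v)),
      finExplicitDelta L v H' (x * a * x⁻¹) μ b = finExplicitDelta L v H' a μ b)
    (hr : ∀ (v : HeightOneSpectrum (𝓞 ↥(maximalRealSubfield L))) (a : ((cmDatum L 2 (Matrix.of fun i j : Fin 2 => if i.val + j.val + 1 = 2 then (1 : L) else 0)).Local v ×
      (cmDatum L 1 (Matrix.of fun i j : Fin 1 => if i.val + j.val + 1 = 1 then (1 : L) else 0)).Local v)) (b y : (cmDatum L 3 H').Local v),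
      finExplicitDelta L v H' a μ (y * b * y⁻¹) = finExplicitDelta L v H' a μ b)
    (νH : Measure ((cmDatum L 2 (Matrix.of fun i j : Fin 2 => if i.val + j.val + 1 = 2 then (1 : L) else 0)).Local v ×
      (cmDatum L 1 (Matrix.of fun i j : Fin 1 => if i.val + j.val + 1 = 1 then (1 : L) else 0)).Local v)) [νH.IsHaarMeasure] [νH.IsMulRightInvariant]
    (νG : Measure ((cmDatum L 3 H').Local v)) [νG.IsHaarMeasure] [νG.IsMulRightInvariant]
    {mH : OrbitalMeasureFamily ((cmDatum L 2 (Matrix.of fun i j : Fin 2 => if i.val + j.val + 1 = 2 then (1 : L) else 0)).Local v ×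
      (cmDatum L 1 (Matrix.of fun i j : Fin 1 => if i.val + j.val + 1 = 1 then (1 : L) else 0)).Local v)} {mG : OrbitalMeasureFamily ((cmDatum L 3 H').Local v)}
    (hmH : mH.IsCanonical (IsLocalGRegular L v) νH)
    (hmG : mG.IsCanonical (fun γ : (cmDatum L 3 H').Local v => IsRegularElt (γ.val : GL (Fin 3) (LocalRing L v))) νG)
    -- (2ᵀ) the `H_v`-charts in torus coordinates at every `G`-regular `γ_H`
    (hchartH : ∀ γH : ((cmDatum L 2 (Matrix.of fun i j : Fin 2 => if i.val + j.val + 1 = 2 then (1 : L) else 0)).Local v ×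
      (cmDatum L 1 (Matrix.of fun i j : Fin 1 => if i.val + j.val + 1 = 1 then (1 : L) else 0)).Local v), IsLocalGRegular L v γH →
      ∃ (A : Type) (_ : TopologicalSpace A) (s : A → ((cmDatum L 2 (Matrix.of fun i j : Fin 2 => if i.val + j.val + 1 = 2 then (1 : L) else 0)).Local v ×
      (cmDatum L 1 (Matrix.of fun i j : Fin 1 => if i.val + j.val + 1 = 1 then (1 : L) else 0)).Local v)) (e : OpenPartialHomeomorph (A × ↥(Subgroup.centralizer ({γH} : Set ((cmDatum L 2 (Matrix.of fun i j : Fin 2 => if i.val + j.val + 1 = 2 then (1 : L) else 0)).Local v ×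
      (cmDatum L 1 (Matrix.of fun i j : Fin 1 => if i.val + j.val + 1 = 1 then (1 : L) else 0)).Local v)))) ((cmDatum L 2 (Matrix.of fun i j : Fin 2 => if i.val + j.val + 1 = 2 then (1 : L) else 0)).Local v ×
      (cmDatum L 1 (Matrix.of fun i j : Fin 1 => if i.val + j.val + 1 = 1 then (1 : L) else 0)).Local v))
        (K : Set A) (B₁ : Set ↥(Subgroup.centralizer ({γH} : Set ((cmDatum L 2 (Matrix.of fun i j : Fin 2 => if i.val + j.val + 1 = 2 then (1 : L) else 0)).Local v ×
      (cmDatum L 1 (Matrix.of fun i j : Fin 1 => if i.val + j.val + 1 = 1 then (1 : L) else 0)).Local v)))) (a₀ : A) (b₀ : ↥(Subgroup.centralizer ({γH} : Set ((cmDatum L 2 (Matrix.of fun i j : Fin 2 => if i.val + j.val + 1 = 2 then (1 : L) else 0)).Local v ×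
      (cmDatum L 1 (Matrix.of fun i j : Fin 1 => if i.val + j.val + 1 = 1 then (1 : L) else 0)).Local v)))),
        Continuous s ∧ (∀ p ∈ e.source, e p = s p.1 * (p.2 : ((cmDatum L 2 (Matrix.of fun i j : Fin 2 => if i.val + j.val + 1 = 2 then (1 : L) else 0)).Local v ×
      (cmDatum L 1 (Matrix.of fun i j : Fin 1 => if i.val + j.val + 1 = 1 then (1 : L) else 0)).Local v)) * (s p.1)⁻¹) ∧ IsCompact K ∧ IsOpen K ∧ a₀ ∈ K ∧ IsOpen B₁ ∧
        (b₀ : ((cmDatum L 2 (Matrix.of fun i j : Fin 2 => if i.val + j.val + 1 = 2 then (1 : L) else 0)).Local v ×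
      (cmDatum L 1 (Matrix.of fun i j : Fin 1 => if i.val + j.val + 1 = 1 then (1 : L) else 0)).Local v)) = γH ∧ b₀ ∈ B₁ ∧ K ×ˢ B₁ ⊆ e.source ∧
        (∀ b ∈ B₁, IsLocalGRegular L v (b : ((cmDatum L 2 (Matrix.of fun i j : Fin 2 => if i.val + j.val + 1 = 2 then (1 : L) else 0)).Local v ×
      (cmDatum L 1 (Matrix.of fun i j : Fin 1 => if i.val + j.val + 1 = 1 then (1 : L) else 0)).Local v)) ∧
          Subgroup.centralizer ({(b : ((cmDatum L 2 (Matrix.of fun i j : Fin 2 => if i.val + j.val + 1 = 2 then (1 : L) else 0)).Local v ×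
      (cmDatum L 1 (Matrix.of fun i j : Fin 1 => if i.val + j.val + 1 = 1 then (1 : L) else 0)).Local v))} : Set ((cmDatum L 2 (Matrix.of fun i j : Fin 2 => if i.val + j.val + 1 = 2 then (1 : L) else 0)).Local v ×
      (cmDatum L 1 (Matrix.of fun i j : Fin 1 => if i.val + j.val + 1 = 1 then (1 : L) else 0)).Local v)) = Subgroup.centralizer ({γH} : Set ((cmDatum L 2 (Matrix.of fun i j : Fin 2 => if i.val + j.val + 1 = 2 then (1 : L) else 0)).Local v ×
      (cmDatum L 1 (Matrix.of fun i j : Fin 1 => if i.val + j.val + 1 = 1 then (1 : L) else 0)).Local v))) ∧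
        (∀ b ∈ B₁, ∀ x : ((cmDatum L 2 (Matrix.of fun i j : Fin 2 => if i.val + j.val + 1 = 2 then (1 : L) else 0)).Local v ×
      (cmDatum L 1 (Matrix.of fun i j : Fin 1 => if i.val + j.val + 1 = 1 then (1 : L) else 0)).Local v), x * (b : ((cmDatum L 2 (Matrix.of fun i j : Fin 2 => if i.val + j.val + 1 = 2 then (1 : L) else 0)).Local v ×
      (cmDatum L 1 (Matrix.of fun i j : Fin 1 => if i.val + j.val + 1 = 1 then (1 : L) else 0)).Local v)) * x⁻¹ ∈ e '' (K ×ˢ B₁) →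
          x ∈ s '' K * ((Subgroup.centralizer ({γH} : Set ((cmDatum L 2 (Matrix.of fun i j : Fin 2 => if i.val + j.val + 1 = 2 then (1 : L) else 0)).Local v ×
      (cmDatum L 1 (Matrix.of fun i j : Fin 1 => if i.val + j.val + 1 = 1 then (1 : L) else 0)).Local v)) : Subgroup ((cmDatum L 2 (Matrix.of fun i j : Fin 2 => if i.val + j.val + 1 = 2 then (1 : L) else 0)).Local v ×
      (cmDatum L 1 (Matrix.of fun i j : Fin 1 => if i.val + j.val + 1 = 1 then (1 : L) else 0)).Local v)) : Set ((cmDatum L 2 (Matrix.of fun i j : Fin 2 => if i.val + j.val + 1 = 2 then (1 : L) else 0)).Local v ×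
      (cmDatum L 1 (Matrix.of fun i j : Fin 1 => if i.val + j.val + 1 = 1 then (1 : L) else 0)).Local v))) ∧
        (∀ b ∈ B₁, ∀ b' ∈ B₁, IsLocalStablyConjH L v (b : ((cmDatum L 2 (Matrix.of fun i j : Fin 2 => if i.val + j.val + 1 = 2 then (1 : L) else 0)).Local v ×
      (cmDatum L 1 (Matrix.of fun i j : Fin 1 => if i.val + j.val + 1 = 1 then (1 : L) else 0)).Local v)) (b' : ((cmDatum L 2 (Matrix.of fun i j : Fin 2 => if i.val + j.val + 1 = 2 then (1 : L) else 0)).Local v ×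
      (cmDatum L 1 (Matrix.of fun i j : Fin 1 => if i.val + j.val + 1 = 1 then (1 : L) else 0)).Local v)) → b = b'))
    -- (1ᵀ) the `G′_v`-charts in torus coordinates at every regular `γ₀`, with shrinking
    (hchartG : ∀ γ₀ : (cmDatum L 3 H').Local v, IsRegularElt (γ₀.val : GL (Fin 3) (LocalRing L v)) →
      ∃ (AG : Type) (_ : TopologicalSpace AG) (sG : AG → (cmDatum L 3 H').Local v) (eG : OpenPartialHomeomorph (AG × ↥(Subgroup.centralizer ({γ₀} : Set ((cmDatum L 3 H').Local v)))) ((cmDatum L 3 H').Local v)) (aG : AG) (b₀G : ↥(Subgroup.centralizer ({γ₀} : Set ((cmDatum L 3 H').Local v)))),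
        (∀ p ∈ eG.source, eG p = sG p.1 * (p.2 : (cmDatum L 3 H').Local v) * (sG p.1)⁻¹) ∧ sG aG = 1 ∧ (b₀G : (cmDatum L 3 H').Local v) = γ₀ ∧
        ∀ N ∈ 𝓝 (aG, b₀G), ∃ (K : Set AG) (B : Set ↥(Subgroup.centralizer ({γ₀} : Set ((cmDatum L 3 H').Local v)))), IsCompact K ∧ IsOpen K ∧ aG ∈ K ∧ IsCompact B ∧ IsOpen B ∧ b₀G ∈ B ∧
          K ×ˢ B ⊆ N ∧ K ×ˢ B ⊆ eG.source ∧ (∀ b ∈ B, IsRegularElt ((b : (cmDatum L 3 H').Local v).val : GL (Fin 3) (LocalRing L v))) ∧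
          (∀ b ∈ B, ∀ b' ∈ B, IsConj ((b : (cmDatum L 3 H').Local v).val : GL (Fin 3) (LocalRing L v)) (b' : (cmDatum L 3 H').Local v).val → b = b'))
    -- (G1-i) local constancy of the regular orbital integrals along every `Z_{G′_v}(γ₀)`
    (hOlcG : ∀ γ₀ : (cmDatum L 3 H').Local v, IsRegularElt (γ₀.val : GL (Fin 3) (LocalRing L v)) → ∀ ψ : (cmDatum L 3 H').Local v → ℂ, IsLocSmooth ψ → ∀ t₀ : ↥(Subgroup.centralizer ({γ₀} : Set ((cmDatum L 3 H').Local v))),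
      IsRegularElt (((t₀ : (cmDatum L 3 H').Local v)).val : GL (Fin 3) (LocalRing L v)) →
      ∀ᶠ t : ↥(Subgroup.centralizer ({γ₀} : Set ((cmDatum L 3 H').Local v))) in 𝓝 t₀, classOrbitalIntegral mG ψ (ConjClasses.mk (t : (cmDatum L 3 H').Local v)) =
        classOrbitalIntegral mG ψ (ConjClasses.mk (t₀ : (cmDatum L 3 H').Local v)))
    (φ : (cmDatum L 3 H').Local v → ℂ) (hφ : IsLocSmooth φ) (hφreg : tsupport φ ⊆ {γ : (cmDatum L 3 H').Local v | IsRegularElt (γ.val : GL (Fin 3) (LocalRing L v))}) :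
    ∃ φH : ((cmDatum L 2 (Matrix.of fun i j : Fin 2 => if i.val + j.val + 1 = 2 then (1 : L) else 0)).Local v ×
      (cmDatum L 1 (Matrix.of fun i j : Fin 1 => if i.val + j.val + 1 = 1 then (1 : L) else 0)).Local v) → ℂ, IsLocSmooth φH ∧ IsLocalDeltaTransfer L H' v ((finExplicitCollection L H' μ hl hr) v) mH mG φH φ := by
  classical
  have hH'd : IsUnit H'.det := isUnit_iff_ne_zero.2 hdet'
  -- the matched regular classes and their charts (§2)
  have hM : ∀ γ : {γ : (cmDatum L 3 H').Local v // IsRegularElt (γ.val : GL (Fin 3) (LocalRing L v)) ∧ ∃ a : ((cmDatum L 2 (Matrix.of fun i j : Fin 2 => if i.val + j.val + 1 = 2 then (1 : L) else 0)).Local v ×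
      (cmDatum L 1 (Matrix.of fun i j : Fin 1 => if i.val + j.val + 1 = 1 then (1 : L) else 0)).Local v), IsLocalGRegular L v a ∧ IsLocalNormPair L H' v a γ},
      ∃ U : Set ((cmDatum L 3 H').Local v), IsOpen U ∧ (γ : (cmDatum L 3 H').Local v) ∈ U ∧ ∀ ψ : (cmDatum L 3 H').Local v → ℂ, IsLocSmooth ψ → tsupport ψ ⊆ U →
        ∃ ψH : ((cmDatum L 2 (Matrix.of fun i j : Fin 2 => if i.val + j.val + 1 = 2 then (1 : L) else 0)).Local v ×
      (cmDatum L 1 (Matrix.of fun i j : Fin 1 => if i.val + j.val + 1 = 1 then (1 : L) else 0)).Local v) → ℂ, IsLocSmooth ψH ∧ IsLocalDeltaTransfer L H' v ((finExplicitCollection L H' μ hl hr) v) mH mG ψH ψ := by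
    intro γ
    obtain ⟨hγ, -⟩ := γ.2
    obtain ⟨S, hS1, hS2, hS3⟩ := exists_finset_normFibre L H' v (γ : (cmDatum L 3 H').Local v)
    obtain ⟨AG, tAG, sG, eG, aG, b₀G, heG, hsG, hb₀G, hNG⟩ := hchartG γ hγ
    exact exists_localTransfer_of_matchedChart_nonsplit L H' v hH' hdet' μ hl hr νH hmH γ hγ S hS1 hS2 hS3 hchartH
      sG eG aG b₀G heG hsG hb₀G hNG (hOlcG γ hγ)
  choose U hUo hUγ hUloc using hM
  refine exists_localTransfer_of_cover L H' v hH' hdet' (OrbitalMeasureFamily.IsCanonical.isAdmissibleOn hmH)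
    (OrbitalMeasureFamily.IsCanonical.isAdmissibleOn hmG)
    (fun i : Option {γ : (cmDatum L 3 H').Local v // IsRegularElt (γ.val : GL (Fin 3) (LocalRing L v)) ∧ ∃ a : ((cmDatum L 2 (Matrix.of fun i j : Fin 2 => if i.val + j.val + 1 = 2 then (1 : L) else 0)).Local v ×
      (cmDatum L 1 (Matrix.of fun i j : Fin 1 => if i.val + j.val + 1 = 1 then (1 : L) else 0)).Local v), IsLocalGRegular L v a ∧ IsLocalNormPair L H' v a γ} =>
      i.elim {γ : (cmDatum L 3 H').Local v | ∀ z : (cmDatum L 1 (Matrix.of fun i j : Fin 1 => if i.val + j.val + 1 = 1 then (1 : L) else 0)).Local v,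
        ¬ ((γ.val.val : Matrix (Fin 3) (Fin 3) (UnitaryGroup.LocalRing L v)).charpoly).IsRoot
          (((z.val.val : Matrix (Fin 1) (Fin 1) (UnitaryGroup.LocalRing L v))) 0 0)} U)
    ?_ ?_ φ hφ ?_
  · rintro (_ | γ)
    · exact isOpen_setOf_forall_not_isRoot_charpoly L H' v w hw
    · exact hUo γ
  · rintro (_ | γ) ψ hψ hsub
    · exact exists_localTransfer_of_tsupport_subset_unmatched L H' v _ mH mG hsub
    · exact hUloc γ ψ hψ hsub
  · intro x hx
    have hxreg : IsRegularElt (x.val : GL (Fin 3) (LocalRing L v)) := hφreg hx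
    by_cases hm : ∃ a : ((cmDatum L 2 (Matrix.of fun i j : Fin 2 => if i.val + j.val + 1 = 2 then (1 : L) else 0)).Local v ×
      (cmDatum L 1 (Matrix.of fun i j : Fin 1 => if i.val + j.val + 1 = 1 then (1 : L) else 0)).Local v), IsLocalGRegular L v a ∧ IsLocalNormPair L H' v a x
    · exact Set.mem_iUnion.2 ⟨some ⟨x, hxreg, hm⟩, hUγ _⟩
    · refine Set.mem_iUnion.2 ⟨none, fun z hz => hm ?_⟩
      obtain ⟨g, hg, hgm⟩ := exists_isLocalGRegular_isLocalNormPair_of_isRoot L H' v w hw hH'd x hxreg z hz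
      exact ⟨(g, z), hg, hgm⟩

/-- **(T1) «N6-ns-reg» WITH (G1-i) DISCHARGED (ED. 2 rider).**  The same headline with the local constancy of the regular orbital integrals along the
`G′_v`-tori supplied BY NAME: ★ `eventually_classOrbitalIntegral_mk_eq_cmDatum_local` (F0P3a-p03 (g10), `RegularOrbitalIntegralLocallyConstantCM`, the CM dress
of Harish-Chandra's local constancy for a CANONICAL family `mG`).  Remaining binders: the torus-coordinate chart data `hchartH` (A-p16 (2ᵀ)) and `hchartG`
(A-p16 (1ᵀ)) only. [cite: Rogawski1990, §4.9 Prop. 4.9.1 (a) pp. 54–55; §4.3 (4.3.1) p. 43] [cite: HarishChandra1970, Part I §3 Lemmas 13–14] -/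
theorem exists_localTransfer_of_tsupport_subset_regular_nonsplit_of_charts (w : PlacesOver L v) (hw : IsCMField.complexConj L • w.1 = w.1)
    (hH' : (H'.map (cmConjRingHom L))ᵀ = H') (hdet' : H'.det ≠ 0) (μ : HeckeCharacter L)
    (hl : ∀ (v : HeightOneSpectrum (𝓞 ↥(maximalRealSubfield L))) (a : ((cmDatum L 2 (Matrix.of fun i j : Fin 2 => if i.val + j.val + 1 = 2 then (1 : L) else 0)).Local v ×
      (cmDatum L 1 (Matrix.of fun i j : Fin 1 => if i.val + j.val + 1 = 1 then (1 : L) else 0)).Local v)) (b : (cmDatum L 3 H').Local v) (x : ((cmDatum L 2 (Matrix.of fun i j : Fin 2 => if i.val + j.val + 1 = 2 then (1 : L) else 0)).Local v ×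
      (cmDatum L 1 (Matrix.of fun i j : Fin 1 => if i.val + j.val + 1 = 1 then (1 : L) else 0)).Local v)),
      finExplicitDelta L v H' (x * a * x⁻¹) μ b = finExplicitDelta L v H' a μ b)
    (hr : ∀ (v : HeightOneSpectrum (𝓞 ↥(maximalRealSubfield L))) (a : ((cmDatum L 2 (Matrix.of fun i j : Fin 2 => if i.val + j.val + 1 = 2 then (1 : L) else 0)).Local v ×
      (cmDatum L 1 (Matrix.of fun i j : Fin 1 => if i.val + j.val + 1 = 1 then (1 : L) else 0)).Local v)) (b y : (cmDatum L 3 H').Local v),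
      finExplicitDelta L v H' a μ (y * b * y⁻¹) = finExplicitDelta L v H' a μ b)
    (νH : Measure ((cmDatum L 2 (Matrix.of fun i j : Fin 2 => if i.val + j.val + 1 = 2 then (1 : L) else 0)).Local v ×
      (cmDatum L 1 (Matrix.of fun i j : Fin 1 => if i.val + j.val + 1 = 1 then (1 : L) else 0)).Local v)) [νH.IsHaarMeasure] [νH.IsMulRightInvariant]
    (νG : Measure ((cmDatum L 3 H').Local v)) [νG.IsHaarMeasure] [νG.IsMulRightInvariant]
    {mH : OrbitalMeasureFamily ((cmDatum L 2 (Matrix.of fun i j : Fin 2 => if i.val + j.val + 1 = 2 then (1 : L) else 0)).Local v ×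
      (cmDatum L 1 (Matrix.of fun i j : Fin 1 => if i.val + j.val + 1 = 1 then (1 : L) else 0)).Local v)} {mG : OrbitalMeasureFamily ((cmDatum L 3 H').Local v)}
    (hmH : mH.IsCanonical (IsLocalGRegular L v) νH)
    (hmG : mG.IsCanonical (fun γ : (cmDatum L 3 H').Local v => IsRegularElt (γ.val : GL (Fin 3) (LocalRing L v))) νG)
    -- (2ᵀ) the `H_v`-charts in torus coordinates at every `G`-regular `γ_H`
    (hchartH : ∀ γH : ((cmDatum L 2 (Matrix.of fun i j : Fin 2 => if i.val + j.val + 1 = 2 then (1 : L) else 0)).Local v ×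
      (cmDatum L 1 (Matrix.of fun i j : Fin 1 => if i.val + j.val + 1 = 1 then (1 : L) else 0)).Local v), IsLocalGRegular L v γH →
      ∃ (A : Type) (_ : TopologicalSpace A) (s : A → ((cmDatum L 2 (Matrix.of fun i j : Fin 2 => if i.val + j.val + 1 = 2 then (1 : L) else 0)).Local v ×
      (cmDatum L 1 (Matrix.of fun i j : Fin 1 => if i.val + j.val + 1 = 1 then (1 : L) else 0)).Local v)) (e : OpenPartialHomeomorph (A × ↥(Subgroup.centralizer ({γH} : Set ((cmDatum L 2 (Matrix.of fun i j : Fin 2 => if i.val + j.val + 1 = 2 then (1 : L) else 0)).Local v ×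
      (cmDatum L 1 (Matrix.of fun i j : Fin 1 => if i.val + j.val + 1 = 1 then (1 : L) else 0)).Local v)))) ((cmDatum L 2 (Matrix.of fun i j : Fin 2 => if i.val + j.val + 1 = 2 then (1 : L) else 0)).Local v ×
      (cmDatum L 1 (Matrix.of fun i j : Fin 1 => if i.val + j.val + 1 = 1 then (1 : L) else 0)).Local v))
        (K : Set A) (B₁ : Set ↥(Subgroup.centralizer ({γH} : Set ((cmDatum L 2 (Matrix.of fun i j : Fin 2 => if i.val + j.val + 1 = 2 then (1 : L) else 0)).Local v ×
      (cmDatum L 1 (Matrix.of fun i j : Fin 1 => if i.val + j.val + 1 = 1 then (1 : L) else 0)).Local v)))) (a₀ : A) (b₀ : ↥(Subgroup.centralizer ({γH} : Set ((cmDatum L 2 (Matrix.of fun i j : Fin 2 => if i.val + j.val + 1 = 2 then (1 : L) else 0)).Local v ×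
      (cmDatum L 1 (Matrix.of fun i j : Fin 1 => if i.val + j.val + 1 = 1 then (1 : L) else 0)).Local v)))),
        Continuous s ∧ (∀ p ∈ e.source, e p = s p.1 * (p.2 : ((cmDatum L 2 (Matrix.of fun i j : Fin 2 => if i.val + j.val + 1 = 2 then (1 : L) else 0)).Local v ×
      (cmDatum L 1 (Matrix.of fun i j : Fin 1 => if i.val + j.val + 1 = 1 then (1 : L) else 0)).Local v)) * (s p.1)⁻¹) ∧ IsCompact K ∧ IsOpen K ∧ a₀ ∈ K ∧ IsOpen B₁ ∧
        (b₀ : ((cmDatum L 2 (Matrix.of fun i j : Fin 2 => if i.val + j.val + 1 = 2 then (1 : L) else 0)).Local v ×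
      (cmDatum L 1 (Matrix.of fun i j : Fin 1 => if i.val + j.val + 1 = 1 then (1 : L) else 0)).Local v)) = γH ∧ b₀ ∈ B₁ ∧ K ×ˢ B₁ ⊆ e.source ∧
        (∀ b ∈ B₁, IsLocalGRegular L v (b : ((cmDatum L 2 (Matrix.of fun i j : Fin 2 => if i.val + j.val + 1 = 2 then (1 : L) else 0)).Local v ×
      (cmDatum L 1 (Matrix.of fun i j : Fin 1 => if i.val + j.val + 1 = 1 then (1 : L) else 0)).Local v)) ∧
          Subgroup.centralizer ({(b : ((cmDatum L 2 (Matrix.of fun i j : Fin 2 => if i.val + j.val + 1 = 2 then (1 : L) else 0)).Local v ×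
      (cmDatum L 1 (Matrix.of fun i j : Fin 1 => if i.val + j.val + 1 = 1 then (1 : L) else 0)).Local v))} : Set ((cmDatum L 2 (Matrix.of fun i j : Fin 2 => if i.val + j.val + 1 = 2 then (1 : L) else 0)).Local v ×
      (cmDatum L 1 (Matrix.of fun i j : Fin 1 => if i.val + j.val + 1 = 1 then (1 : L) else 0)).Local v)) = Subgroup.centralizer ({γH} : Set ((cmDatum L 2 (Matrix.of fun i j : Fin 2 => if i.val + j.val + 1 = 2 then (1 : L) else 0)).Local v ×
      (cmDatum L 1 (Matrix.of fun i j : Fin 1 => if i.val + j.val + 1 = 1 then (1 : L) else 0)).Local v))) ∧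
        (∀ b ∈ B₁, ∀ x : ((cmDatum L 2 (Matrix.of fun i j : Fin 2 => if i.val + j.val + 1 = 2 then (1 : L) else 0)).Local v ×
      (cmDatum L 1 (Matrix.of fun i j : Fin 1 => if i.val + j.val + 1 = 1 then (1 : L) else 0)).Local v), x * (b : ((cmDatum L 2 (Matrix.of fun i j : Fin 2 => if i.val + j.val + 1 = 2 then (1 : L) else 0)).Local v ×
      (cmDatum L 1 (Matrix.of fun i j : Fin 1 => if i.val + j.val + 1 = 1 then (1 : L) else 0)).Local v)) * x⁻¹ ∈ e '' (K ×ˢ B₁) →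
          x ∈ s '' K * ((Subgroup.centralizer ({γH} : Set ((cmDatum L 2 (Matrix.of fun i j : Fin 2 => if i.val + j.val + 1 = 2 then (1 : L) else 0)).Local v ×
      (cmDatum L 1 (Matrix.of fun i j : Fin 1 => if i.val + j.val + 1 = 1 then (1 : L) else 0)).Local v)) : Subgroup ((cmDatum L 2 (Matrix.of fun i j : Fin 2 => if i.val + j.val + 1 = 2 then (1 : L) else 0)).Local v ×
      (cmDatum L 1 (Matrix.of fun i j : Fin 1 => if i.val + j.val + 1 = 1 then (1 : L) else 0)).Local v)) : Set ((cmDatum L 2 (Matrix.of fun i j : Fin 2 => if i.val + j.val + 1 = 2 then (1 : L) else 0)).Local v ×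
      (cmDatum L 1 (Matrix.of fun i j : Fin 1 => if i.val + j.val + 1 = 1 then (1 : L) else 0)).Local v))) ∧
        (∀ b ∈ B₁, ∀ b' ∈ B₁, IsLocalStablyConjH L v (b : ((cmDatum L 2 (Matrix.of fun i j : Fin 2 => if i.val + j.val + 1 = 2 then (1 : L) else 0)).Local v ×
      (cmDatum L 1 (Matrix.of fun i j : Fin 1 => if i.val + j.val + 1 = 1 then (1 : L) else 0)).Local v)) (b' : ((cmDatum L 2 (Matrix.of fun i j : Fin 2 => if i.val + j.val + 1 = 2 then (1 : L) else 0)).Local v ×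
      (cmDatum L 1 (Matrix.of fun i j : Fin 1 => if i.val + j.val + 1 = 1 then (1 : L) else 0)).Local v)) → b = b'))
    -- (1ᵀ) the `G′_v`-charts in torus coordinates at every regular `γ₀`, with shrinking
    (hchartG : ∀ γ₀ : (cmDatum L 3 H').Local v, IsRegularElt (γ₀.val : GL (Fin 3) (LocalRing L v)) →
      ∃ (AG : Type) (_ : TopologicalSpace AG) (sG : AG → (cmDatum L 3 H').Local v) (eG : OpenPartialHomeomorph (AG × ↥(Subgroup.centralizer ({γ₀} : Set ((cmDatum L 3 H').Local v)))) ((cmDatum L 3 H').Local v)) (aG : AG) (b₀G : ↥(Subgroup.centralizer ({γ₀} : Set ((cmDatum L 3 H').Local v)))),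
        (∀ p ∈ eG.source, eG p = sG p.1 * (p.2 : (cmDatum L 3 H').Local v) * (sG p.1)⁻¹) ∧ sG aG = 1 ∧ (b₀G : (cmDatum L 3 H').Local v) = γ₀ ∧
        ∀ N ∈ 𝓝 (aG, b₀G), ∃ (K : Set AG) (B : Set ↥(Subgroup.centralizer ({γ₀} : Set ((cmDatum L 3 H').Local v)))), IsCompact K ∧ IsOpen K ∧ aG ∈ K ∧ IsCompact B ∧ IsOpen B ∧ b₀G ∈ B ∧
          K ×ˢ B ⊆ N ∧ K ×ˢ B ⊆ eG.source ∧ (∀ b ∈ B, IsRegularElt ((b : (cmDatum L 3 H').Local v).val : GL (Fin 3) (LocalRing L v))) ∧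
          (∀ b ∈ B, ∀ b' ∈ B, IsConj ((b : (cmDatum L 3 H').Local v).val : GL (Fin 3) (LocalRing L v)) (b' : (cmDatum L 3 H').Local v).val → b = b'))
    (φ : (cmDatum L 3 H').Local v → ℂ) (hφ : IsLocSmooth φ) (hφreg : tsupport φ ⊆ {γ : (cmDatum L 3 H').Local v | IsRegularElt (γ.val : GL (Fin 3) (LocalRing L v))}) :
    ∃ φH : ((cmDatum L 2 (Matrix.of fun i j : Fin 2 => if i.val + j.val + 1 = 2 then (1 : L) else 0)).Local v ×
      (cmDatum L 1 (Matrix.of fun i j : Fin 1 => if i.val + j.val + 1 = 1 then (1 : L) else 0)).Local v) → ℂ, IsLocSmooth φH ∧ IsLocalDeltaTransfer L H' v ((finExplicitCollection L H' μ hl hr) v) mH mG φH φ :=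
  exists_localTransfer_of_tsupport_subset_regular_nonsplit L H' v w hw hH' hdet' μ hl hr νH νG hmH hmG hchartH hchartG
    (fun _ hγ₀ _ hψ t₀ ht₀ => eventually_classOrbitalIntegral_mk_eq_cmDatum_local L H' ((map_cmConjRingHom_eq_map_complexConj L H') ▸ hH')
      (isUnit_iff_ne_zero.2 hdet') w hw hmG hγ₀ hψ t₀ ht₀) φ hφ hφreg

end Headline

end Literature.NumberTheory.Rogawski1990

end
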